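import Literature.MathematicalPhysics.QuantumFieldTheory.Balaban1983to89.Beta.WilsonBiStencil

/-!
# The SYMMETRISED second-order Wilson vertex: slot swaps, transposition, polarisation, and the closed form of the symmetrised traced table

HONEST FRAMING (cell `pub-balaban`, β sub-cell, lineage an3; verbatim): discharging `BetaPertH` makes Bałaban's UV stability
UNCONDITIONAL — a real constructive-QFT result; it is NOT the continuum limit and NOT the Clay problem.  This file discharges NOTHING
of `BetaPertH`.  ABSOLUTE RULE of the cell (verbatim): «No internally-minted statement may enter as a cited fact. Every hypothesis is
either kernel-proved in this package or a verbatim quotation of a PUBLISHED theorem with page reference. The manuscript(s) under audit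
are NOT citable for their own disputed steps — they are the thing under adjudication; programme-internal (2001/route/tribunal) claims
are never citable.»  Accordingly every declaration below is a definition or is kernel-proved here from the imports; NOTHING is cited;
no `def … : Prop` occurs at all.

WHAT THIS FILE IS.  `WilsonVertex2Kron` reads the `B`-Hessian of the `(2,2)`-jet at a coordinate background as
`hess22 τ t e (field t u) = Σ_{p₁} Σ_{p₂} (u p₁ · u p₂) • wilsonVertex₂ τ t e p₁ p₂`, an ORDERED family: only the symmetrisation
`wilsonVertex₂ p₁ p₂ + wilsonVertex₂ p₂ p₁` (and, on the fluctuation side, `M + Mᵀ`) is intrinsic — it is the mixed fourth derivative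
`∂_{W}∂_{W}∂_{B_{p₁}}∂_{B_{p₂}}`.  This file pins the symmetrisation in the three formats of the cell and computes the symmetrised
COLOUR-TRACED table in closed form.

§1 TABLE SLOT OPERATIONS on four-position tables `T i j k l` (fluctuation slots `i, j`, background slots `k, l`): `swapIJ`, `swapKL`,
   `symTab T := T + Tᴵᴶ + Tᴷᴸ + Tᴵᴶᴷᴸ` (involutions, commuting, `symTab` fixed by both, linear).
§2 RE-INDEXING IDENTITIES on ANY additive lattice (coloured and colourless): TRANSPOSITION
   `(bondPairMat e u₁ κ₁ u₂ κ₂ M)ᵀ = bondPairMat e u₁ κ₁ u₂ κ₂ (M j i k l b a)` and the **BOND-PAIR SWAP = BACKGROUND-SLOT SWAP**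
   `bondPairMat e u₂ κ₂ u₁ κ₁ M = bondPairMat e u₁ κ₁ u₂ κ₂ (M i j l k)` (a cell `(μ,ν;k,l)` through `((u₂,κ₂),(u₁,κ₁))` IS the cell
   `(μ,ν;l,k)` through `((u₁,κ₁),(u₂,κ₂))`, same base point); colourless twins `bondPairTab_transpose = … (swapIJ T)`,
   `bondPairTab_swap = … (swapKL T)`; for the Wilson vertex `wilsonVertex₂ τ t e p₂ p₁ = bondPairMat … (K22 τ t i j l k a b d c)` (slots AND
   background letters swapped) and its transpose.
§3 POLARISATION on a finite torus: `hess22 (field t (u + u′)) − hess22 (field t u) − hess22 (field t u′)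
   = Σ_{p₁,p₂} (u p₁ · u′ p₂) • (wilsonVertex₂ p₁ p₂ + wilsonVertex₂ p₂ p₁)` — the symmetric `B`-bilinear form; on the `W` side the
   polarisation of `v ↦ v ⬝ᵥ M *ᵥ v` is `v ⬝ᵥ (M + Mᵀ) *ᵥ v′` (`jet22_polar_left` via `PlaquetteVertex2Stencil.jet22_field_quadForm`).
§4 THE CLOSED FORM OF THE SYMMETRISED COLOUR-TRACED TABLE.  With the interleaving indicator
   **`chi i j k l := ((inc_{ik} − inc_{jk})² − (inc_{il} − inc_{jl})²)² ∈ {0, 1}`** («exactly ONE of the two background letters lies between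
   the two fluctuation letters on the plaquette path»; 64 of the 256 quadruples) and `wsym22 N i j k l := s_i s_j s_k s_l·((N² − 1) − N²·chi)`:
   **`symTab (w22 N) = wsym22 N`** (`PlaquetteVertex2Trace.w22`; proof: the `N`-free split `w22_eq_sq_add`, then `fin_cases`).  So the
   `(N² − 1)`-part of the symmetrised traced vertex is the RANK-ONE table `s ⊗ s ⊗ s ⊗ s` (`(curl W)²(curl B)²` in field language) and the
   `N²`-part is minus the signed interleaving indicator; up to the sign `s_i s_j s_k s_l` the symmetrised traced weight takes exactly TWO
   values, `N² − 1` off the interleaving set and `−1` (an `N`-free integer) on it.  Coloured traced form from `PlaquetteVertex2Trace.sum_K22_diag`: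
   `Σ_a (K22 i j k l a a c d + K22 j i k l a a c d + K22 i j l k a a d c + K22 j i l k a a d c) = [c = d]·wsym22 N i j k l`.
§5 THE CONSUMER'S FORMAT (`WilsonBiStencil.wilsonW₂ d T κ u κ′ u′ : MKer (d+1) (Fib d)` on `ℤ^{d+1}`): PAIR SWAP
   `wilsonW₂ d T κ′ u′ κ u = wilsonW₂ d (swapKL T) κ u κ′ u′`, LEG TRANSPOSITION `wilsonW₂ d T κ u κ′ u′ z x b a = wilsonW₂ d (swapIJ T) κ u κ′ u′ x z a b`;
   hence `wilsonW₂ d (symTab T)` is PAIR-SYMMETRIC and LEG-SYMMETRIC and is the four-term symmetrisation of `wilsonW₂ d T`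
   (CONTRAST: the first-order families are leg-ANTIsymmetric by the convention `BalabanCompositeJets.Sc_antisymm`; at second order the
   traced colour factor `δ_{cd}` is symmetric, so the symmetrised table is leg-symmetric); `tabSum` is swap-invariant and subadditive, so
   `wBound₂ d (symTab T) ≤ 4·wBound₂ d T`, and the bi-localisation certificate of `wilsonW₂ d (symTab T)` is `WilsonBiStencil.biLoc_wilsonW₂`
   BY NAME.
§6 Kernel-checked examples (the two values; the `(0,3)` fluctuation pair never interleaves; the symmetrised Wilson family in the
   `LocStencil₂` shape).

COLOUR SIDE.  Symmetrising a colour matrix never changes a traced weight (`ColourWordMatrices.trace_half_add_transpose`, lit1, BY NAME —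
not imported here): the statements of §4 are therefore the complete traced content of the symmetrisation.  NOT decided here: which
normalisation (`symTab` = the fourth derivative, or `¼·symTab` = the Taylor coefficient) a consumer's `S₂` slot takes — both are one
`wilsonW₂_smul` away.
-/

open Finset
open scoped BigOperators Matrix
open Literature.MathematicalPhysics.QuantumFieldTheory.Balaban1983to89
open Literature.MathematicalPhysics.QuantumFieldTheory.Balaban1983to89.Beta
open ColourTrace (Complete TrOrthonormal)
open PlaquetteVertex (rntr gen field)
open PlaquetteVertex2 (jet22)
open PlaquetteVertex2Coords (sgn)
open PlaquetteVertex2Polar (K22 inc qq)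
open PlaquetteVertex2Trace (w22 w22_eq_sq_add sum_K22_diag)
open PlaquetteVertex2Stencil (dir off plaqMat hess22 jet22_field_quadForm)
open WilsonVertex2Kron (plaqMat_apply cell bondPairMat plaqTab plaqTab_apply cellTab bondPairTab ite_apply₂ K22ker wilsonVertex₂
  hess22_field_eq_sum_wilsonVertex₂ stab)
open WilsonVertex2Loc (tabSum)
open WilsonBiStencil (wEntry₂ wilsonW₂ wBound₂ wilsonW₂_add biLoc_wilsonW₂)
open B12Sec2to5 (l1)
open ExpKernelCalculus (BiLoc)
open OneStepResolventKernel (Fib)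
open B6BondElimination (unitVec)

noncomputable section

namespace Literature.MathematicalPhysics.QuantumFieldTheory.Balaban1983to89.Beta.WilsonVertex2Sym

/-! ## §1 Slot operations on four-position tables -/

section Slots

variable (T T' : Fin 4 → Fin 4 → Fin 4 → Fin 4 → ℝ)

/-- swap of the two FLUCTUATION slots: `(swapIJ T) i j k l := T j i k l`. [folklore] -/
def swapIJ (T : Fin 4 → Fin 4 → Fin 4 → Fin 4 → ℝ) : Fin 4 → Fin 4 → Fin 4 → Fin 4 → ℝ := fun i j k l => T j i k l

/-- swap of the two BACKGROUND slots: `(swapKL T) i j k l := T i j l k`. [folklore] -/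
def swapKL (T : Fin 4 → Fin 4 → Fin 4 → Fin 4 → ℝ) : Fin 4 → Fin 4 → Fin 4 → Fin 4 → ℝ := fun i j k l => T i j l k

/-- **THE SYMMETRISED TABLE** `symTab T i j k l := T i j k l + T j i k l + T i j l k + T j i l k` — the table of the mixed fourth derivative
when `T` is the table of an ordered second-order Taylor coefficient. [folklore] -/
def symTab (T : Fin 4 → Fin 4 → Fin 4 → Fin 4 → ℝ) : Fin 4 → Fin 4 → Fin 4 → Fin 4 → ℝ :=
  fun i j k l => T i j k l + T j i k l + T i j l k + T j i l k

/-- `swapIJ` is an involution. [folklore] -/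
theorem swapIJ_swapIJ : swapIJ (swapIJ T) = T := rfl

/-- `swapKL` is an involution. [folklore] -/
theorem swapKL_swapKL : swapKL (swapKL T) = T := rfl

/-- the two swaps commute. [folklore] -/
theorem swapIJ_swapKL : swapIJ (swapKL T) = swapKL (swapIJ T) := rfl

/-- `symTab T = T + Tᴵᴶ + Tᴷᴸ + Tᴵᴶᴷᴸ` as a sum of tables. [folklore] -/
theorem symTab_eq_add : symTab T = T + swapIJ T + swapKL T + swapIJ (swapKL T) := rfl

/-- the symmetrised table is fixed by the fluctuation swap. [folklore] -/
theorem swapIJ_symTab : swapIJ (symTab T) = symTab T := by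
  funext i j k l
  simp only [swapIJ, symTab]
  ring

/-- the symmetrised table is fixed by the background swap. [folklore] -/
theorem swapKL_symTab : swapKL (symTab T) = symTab T := by
  funext i j k l
  simp only [swapKL, symTab]
  ring

/-- a table fixed by both swaps is a quarter of its symmetrisation. [folklore] -/
theorem symTab_eq_four_smul_of_fixed (hIJ : swapIJ T = T) (hKL : swapKL T = T) : symTab T = (4 : ℝ) • T := by
  funext i j k l
  have h1 : T j i k l = T i j k l := congrFun (congrFun (congrFun (congrFun hIJ i) j) k) l
  have h2 : T i j l k = T i j k l := congrFun (congrFun (congrFun (congrFun hKL i) j) k) l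
  have h3 : T j i l k = T i j k l := by
    have h := congrFun (congrFun (congrFun (congrFun hKL j) i) k) l
    simp only [swapKL] at h
    rw [h]
    exact h1
  show T i j k l + T j i k l + T i j l k + T j i l k = 4 * T i j k l
  rw [h1, h2, h3]
  ring

/-- `symTab` is additive. [folklore] -/
theorem symTab_add : symTab (T + T') = symTab T + symTab T' := by
  funext i j k l
  simp only [symTab, Pi.add_apply]
  ring

/-- `symTab` is homogeneous. [folklore] -/
theorem symTab_smul (r : ℝ) : symTab (r • T) = r • symTab T := by
  funext i j k l
  simp only [symTab, Pi.smul_apply, smul_eq_mul]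
  ring

/-- `tabSum` is invariant under the fluctuation swap. [folklore] -/
theorem tabSum_swapIJ : tabSum (swapIJ T) = tabSum T := by
  unfold tabSum swapIJ
  exact Finset.sum_congr rfl fun k _ => Finset.sum_congr rfl fun l _ => Finset.sum_comm

/-- `tabSum` is invariant under the background swap. [folklore] -/
theorem tabSum_swapKL : tabSum (swapKL T) = tabSum T := by
  unfold tabSum swapKL
  exact Finset.sum_comm

/-- `tabSum` is subadditive. [folklore] -/
theorem tabSum_add_le : tabSum (T + T') ≤ tabSum T + tabSum T' := by
  unfold tabSum
  calc ∑ k, ∑ l, ∑ i, ∑ j, |(T + T') i j k l| ≤ ∑ k, ∑ l, ∑ i, ∑ j, (|T i j k l| + |T' i j k l|) := by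
        gcongr with k _ l _ i _ j _
        exact abs_add_le _ _
    _ = _ := by simp only [Finset.sum_add_distrib]

/-- `tabSum (symTab T) ≤ 4·tabSum T`. [folklore] -/
theorem tabSum_symTab_le : tabSum (symTab T) ≤ 4 * tabSum T := by
  rw [symTab_eq_add]
  calc tabSum (T + swapIJ T + swapKL T + swapIJ (swapKL T))
        ≤ tabSum (T + swapIJ T + swapKL T) + tabSum (swapIJ (swapKL T)) := tabSum_add_le _ _
    _ ≤ tabSum (T + swapIJ T) + tabSum (swapKL T) + tabSum (swapIJ (swapKL T)) := by
        gcongr; exact tabSum_add_le _ _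
    _ ≤ tabSum T + tabSum (swapIJ T) + tabSum (swapKL T) + tabSum (swapIJ (swapKL T)) := by
        gcongr; exact tabSum_add_le _ _
    _ = 4 * tabSum T := by rw [tabSum_swapIJ, tabSum_swapKL, tabSum_swapIJ, tabSum_swapKL]; ring

end Slots

/-! ## §2 Re-indexing identities: transposition and the bond-pair swap -/

section Reindex

variable {Λ : Type*} [DecidableEq Λ] [AddCommGroup Λ] {C : Type*} {D : Type*} [Fintype D] [DecidableEq D]

omit [DecidableEq Λ] [AddCommGroup Λ] [Fintype D] [DecidableEq D] in
/-- a conjunction-guarded `ite` does not see the order of the conjuncts. [folklore] -/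
theorem ite_and_comm (P Q : Prop) [Decidable P] [Decidable Q] (a b : ℝ) :
    (if P ∧ Q then a else b) = if Q ∧ P then a else b := by
  by_cases hP : P <;> by_cases hQ : Q <;> simp [hP, hQ]

omit [Fintype D] in
/-- ENTRIES OF THE TRANSPOSED PLAQUETTE STENCIL: `plaqMat M (q) (p) = plaqMat (M j i b a) p q`. [folklore] -/
theorem plaqMat_transpose_apply (e : D → Λ) (x : Λ) (μ ν : D) (M : Fin 4 → Fin 4 → C → C → ℝ) (y y' : Λ) (a b : C) (α β : D) :
    plaqMat e x μ ν M (y', (b, β)) (y, (a, α)) = plaqMat e x μ ν (fun i j a b => M j i b a) (y, (a, α)) (y', (b, β)) := by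
  rw [plaqMat_apply, plaqMat_apply, Finset.sum_comm]
  refine Finset.sum_congr rfl fun i _ => Finset.sum_congr rfl fun j _ => ?_
  rw [ite_and_comm (y' = _), ite_and_comm (β = _)]

omit [Fintype D] in
/-- **TRANSPOSITION OF THE PLAQUETTE STENCIL**: `(plaqMat e x μ ν M)ᵀ = plaqMat e x μ ν (fun i j a b => M j i b a)`. [folklore] -/
theorem plaqMat_transpose (e : D → Λ) (x : Λ) (μ ν : D) (M : Fin 4 → Fin 4 → C → C → ℝ) :
    (plaqMat e x μ ν M)ᵀ = plaqMat e x μ ν (fun i j a b => M j i b a) := by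
  ext ⟨y, a, α⟩ ⟨y', b, β⟩
  rw [Matrix.transpose_apply]
  exact plaqMat_transpose_apply e x μ ν M y y' a b α β

omit [Fintype D] in
/-- TRANSPOSITION OF A CELL (fluctuation slots and colours swap; background data untouched). [folklore] -/
theorem cell_transpose (e : D → Λ) (u₁ : Λ) (κ₁ : D) (u₂ : Λ) (κ₂ : D) (M : Fin 4 → Fin 4 → Fin 4 → Fin 4 → C → C → ℝ) (μ ν : D)
    (k l : Fin 4) : (cell e u₁ κ₁ u₂ κ₂ M μ ν k l)ᵀ = cell e u₁ κ₁ u₂ κ₂ (fun i j k l a b => M j i k l b a) μ ν k l := by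
  unfold cell
  split_ifs
  · exact plaqMat_transpose e _ μ ν _
  · exact Matrix.transpose_zero

/-- **TRANSPOSITION OF THE TWO-BOND VERTEX**: `(bondPairMat e u₁ κ₁ u₂ κ₂ M)ᵀ = bondPairMat e u₁ κ₁ u₂ κ₂ (fun i j k l a b => M j i k l b a)`. [folklore] -/
theorem bondPairMat_transpose (e : D → Λ) (u₁ : Λ) (κ₁ : D) (u₂ : Λ) (κ₂ : D) (M : Fin 4 → Fin 4 → Fin 4 → Fin 4 → C → C → ℝ) :
    (bondPairMat e u₁ κ₁ u₂ κ₂ M)ᵀ = bondPairMat e u₁ κ₁ u₂ κ₂ (fun i j k l a b => M j i k l b a) := by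
  simp only [bondPairMat, Matrix.transpose_sum, cell_transpose]

omit [Fintype D] in
/-- **THE CELL SWAP**: the cell `(μ,ν;k,l)` through the ordered bond pair `((u₂,κ₂),(u₁,κ₁))` IS the cell `(μ,ν;l,k)` through
`((u₁,κ₁),(u₂,κ₂))` (same plaquette, same base point `u₂ − off k = u₁ − off l`), with the background slots of the kernel swapped. [folklore] -/
theorem cell_swap (e : D → Λ) (u₁ : Λ) (κ₁ : D) (u₂ : Λ) (κ₂ : D) (M : Fin 4 → Fin 4 → Fin 4 → Fin 4 → C → C → ℝ) (μ ν : D)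
    (k l : Fin 4) : cell e u₂ κ₂ u₁ κ₁ M μ ν k l = cell e u₁ κ₁ u₂ κ₂ (fun i j k l => M i j l k) μ ν l k := by
  unfold cell
  by_cases h : dir μ ν k = κ₂ ∧ dir μ ν l = κ₁ ∧ u₂ - off e μ ν k + off e μ ν l = u₁
  · obtain ⟨h1, h2, h3⟩ := h
    have h3' : u₁ - off e μ ν l + off e μ ν k = u₂ := by rw [← h3]; abel
    have hb : u₁ - off e μ ν l = u₂ - off e μ ν k := by rw [← h3]; abel
    rw [if_pos ⟨h1, h2, h3⟩, if_pos ⟨h2, h1, h3'⟩, hb]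
  · have h' : ¬ (dir μ ν l = κ₁ ∧ dir μ ν k = κ₂ ∧ u₁ - off e μ ν l + off e μ ν k = u₂) := by
      rintro ⟨h2, h1, h3⟩
      exact h ⟨h1, h2, by rw [← h3]; abel⟩
    rw [if_neg h, if_neg h']

/-- **THE BOND-PAIR SWAP IS THE BACKGROUND-SLOT SWAP**: `bondPairMat e u₂ κ₂ u₁ κ₁ M = bondPairMat e u₁ κ₁ u₂ κ₂ (fun i j k l => M i j l k)`. [folklore] -/
theorem bondPairMat_swap (e : D → Λ) (u₁ : Λ) (κ₁ : D) (u₂ : Λ) (κ₂ : D) (M : Fin 4 → Fin 4 → Fin 4 → Fin 4 → C → C → ℝ) :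
    bondPairMat e u₂ κ₂ u₁ κ₁ M = bondPairMat e u₁ κ₁ u₂ κ₂ (fun i j k l => M i j l k) := by
  unfold bondPairMat
  refine Finset.sum_congr rfl fun μ _ => Finset.sum_congr rfl fun ν _ => ?_
  rw [Finset.sum_comm]
  exact Finset.sum_congr rfl fun l _ => Finset.sum_congr rfl fun k _ => cell_swap e u₁ κ₁ u₂ κ₂ M μ ν k l

omit [Fintype D] in
/-- ENTRIES OF THE TRANSPOSED COLOURLESS PLAQUETTE STENCIL. [folklore] -/
theorem plaqTab_transpose_apply (e : D → Λ) (x : Λ) (μ ν : D) (T₂ : Fin 4 → Fin 4 → ℝ) (y y' : Λ) (α β : D) :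
    plaqTab e x μ ν T₂ (y', β) (y, α) = plaqTab e x μ ν (fun i j => T₂ j i) (y, α) (y', β) := by
  rw [plaqTab_apply, plaqTab_apply, Finset.sum_comm]
  refine Finset.sum_congr rfl fun i _ => Finset.sum_congr rfl fun j _ => ?_
  rw [ite_and_comm (y' = _), ite_and_comm (β = _)]

omit [Fintype D] in
/-- TRANSPOSITION OF THE COLOURLESS PLAQUETTE STENCIL. [folklore] -/
theorem plaqTab_transpose (e : D → Λ) (x : Λ) (μ ν : D) (T₂ : Fin 4 → Fin 4 → ℝ) :
    (plaqTab e x μ ν T₂)ᵀ = plaqTab e x μ ν (fun i j => T₂ j i) := by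
  ext ⟨y, α⟩ ⟨y', β⟩
  rw [Matrix.transpose_apply]
  exact plaqTab_transpose_apply e x μ ν T₂ y y' α β

omit [Fintype D] in
/-- TRANSPOSITION OF A COLOURLESS CELL. [folklore] -/
theorem cellTab_transpose (e : D → Λ) (u₁ : Λ) (κ₁ : D) (u₂ : Λ) (κ₂ : D) (T : Fin 4 → Fin 4 → Fin 4 → Fin 4 → ℝ) (μ ν : D)
    (k l : Fin 4) : (cellTab e u₁ κ₁ u₂ κ₂ T μ ν k l)ᵀ = cellTab e u₁ κ₁ u₂ κ₂ (swapIJ T) μ ν k l := by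
  unfold cellTab swapIJ
  split_ifs
  · exact plaqTab_transpose e _ μ ν _
  · exact Matrix.transpose_zero

/-- **TRANSPOSITION OF THE COLOURLESS TWO-BOND TABLE = THE FLUCTUATION-SLOT SWAP**:
`(bondPairTab e u₁ κ₁ u₂ κ₂ T)ᵀ = bondPairTab e u₁ κ₁ u₂ κ₂ (swapIJ T)`. [folklore] -/
theorem bondPairTab_transpose (e : D → Λ) (u₁ : Λ) (κ₁ : D) (u₂ : Λ) (κ₂ : D) (T : Fin 4 → Fin 4 → Fin 4 → Fin 4 → ℝ) :
    (bondPairTab e u₁ κ₁ u₂ κ₂ T)ᵀ = bondPairTab e u₁ κ₁ u₂ κ₂ (swapIJ T) := by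
  simp only [bondPairTab, Matrix.transpose_sum, cellTab_transpose]

omit [Fintype D] in
/-- THE COLOURLESS CELL SWAP. [folklore] -/
theorem cellTab_swap (e : D → Λ) (u₁ : Λ) (κ₁ : D) (u₂ : Λ) (κ₂ : D) (T : Fin 4 → Fin 4 → Fin 4 → Fin 4 → ℝ) (μ ν : D)
    (k l : Fin 4) : cellTab e u₂ κ₂ u₁ κ₁ T μ ν k l = cellTab e u₁ κ₁ u₂ κ₂ (swapKL T) μ ν l k := by
  unfold cellTab swapKL
  by_cases h : dir μ ν k = κ₂ ∧ dir μ ν l = κ₁ ∧ u₂ - off e μ ν k + off e μ ν l = u₁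
  · obtain ⟨h1, h2, h3⟩ := h
    have h3' : u₁ - off e μ ν l + off e μ ν k = u₂ := by rw [← h3]; abel
    have hb : u₁ - off e μ ν l = u₂ - off e μ ν k := by rw [← h3]; abel
    rw [if_pos ⟨h1, h2, h3⟩, if_pos ⟨h2, h1, h3'⟩, hb]
  · have h' : ¬ (dir μ ν l = κ₁ ∧ dir μ ν k = κ₂ ∧ u₁ - off e μ ν l + off e μ ν k = u₂) := by
      rintro ⟨h2, h1, h3⟩
      exact h ⟨h1, h2, by rw [← h3]; abel⟩
    rw [if_neg h, if_neg h']

/-- **THE COLOURLESS BOND-PAIR SWAP = THE BACKGROUND-SLOT SWAP**: `bondPairTab e u₂ κ₂ u₁ κ₁ T = bondPairTab e u₁ κ₁ u₂ κ₂ (swapKL T)`. [folklore] -/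
theorem bondPairTab_swap (e : D → Λ) (u₁ : Λ) (κ₁ : D) (u₂ : Λ) (κ₂ : D) (T : Fin 4 → Fin 4 → Fin 4 → Fin 4 → ℝ) :
    bondPairTab e u₂ κ₂ u₁ κ₁ T = bondPairTab e u₁ κ₁ u₂ κ₂ (swapKL T) := by
  unfold bondPairTab
  refine Finset.sum_congr rfl fun μ _ => Finset.sum_congr rfl fun ν _ => ?_
  rw [Finset.sum_comm]
  exact Finset.sum_congr rfl fun l _ => Finset.sum_congr rfl fun k _ => cellTab_swap e u₁ κ₁ u₂ κ₂ T μ ν k l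

/-- the symmetrised table gives a TRANSPOSITION-SYMMETRIC colourless two-bond table. [folklore] -/
theorem bondPairTab_symTab_transpose (e : D → Λ) (u₁ : Λ) (κ₁ : D) (u₂ : Λ) (κ₂ : D) (T : Fin 4 → Fin 4 → Fin 4 → Fin 4 → ℝ) :
    (bondPairTab e u₁ κ₁ u₂ κ₂ (symTab T))ᵀ = bondPairTab e u₁ κ₁ u₂ κ₂ (symTab T) := by
  rw [bondPairTab_transpose, swapIJ_symTab]

/-- … and a PAIR-SYMMETRIC one. [folklore] -/
theorem bondPairTab_symTab_swap (e : D → Λ) (u₁ : Λ) (κ₁ : D) (u₂ : Λ) (κ₂ : D) (T : Fin 4 → Fin 4 → Fin 4 → Fin 4 → ℝ) :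
    bondPairTab e u₂ κ₂ u₁ κ₁ (symTab T) = bondPairTab e u₁ κ₁ u₂ κ₂ (symTab T) := by
  rw [bondPairTab_swap, swapKL_symTab]

end Reindex

section Vertex

variable {𝔸 : Type*} [NormedRing 𝔸] [NormedAlgebra ℝ 𝔸]
variable {Λ : Type*} [DecidableEq Λ] [AddCommGroup Λ] {C : Type*} {D : Type*} [Fintype D] [DecidableEq D]

/-- **THE SWAPPED WILSON VERTEX**: `wilsonVertex₂ τ t e p₂ p₁` is the two-bond vertex through `(p₁, p₂)` of the `(2,2)` colour kernel with
its BACKGROUND SLOTS AND BACKGROUND LETTERS swapped, `(i,j,k,l,a,b) ↦ K22 τ t i j l k a b d c`. [folklore] -/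
theorem wilsonVertex₂_swap (τ : 𝔸 →ₗ[ℝ] ℝ) (t : C → 𝔸) (e : D → Λ) (p₁ p₂ : Λ × (C × D)) :
    wilsonVertex₂ τ t e p₂ p₁
      = bondPairMat e p₁.1 p₁.2.2 p₂.1 p₂.2.2 (fun i j k l a b => K22 τ t i j l k a b p₂.2.1 p₁.2.1) := by
  rw [wilsonVertex₂, bondPairMat_swap]
  rfl

/-- **THE TRANSPOSED WILSON VERTEX**: fluctuation slots and fluctuation colours swapped, `(i,j,k,l,a,b) ↦ K22 τ t j i k l b a c d`. [folklore] -/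
theorem wilsonVertex₂_transpose (τ : 𝔸 →ₗ[ℝ] ℝ) (t : C → 𝔸) (e : D → Λ) (p₁ p₂ : Λ × (C × D)) :
    (wilsonVertex₂ τ t e p₁ p₂)ᵀ
      = bondPairMat e p₁.1 p₁.2.2 p₂.1 p₂.2.2 (fun i j k l a b => K22 τ t j i k l b a p₁.2.1 p₂.2.1) := by
  rw [wilsonVertex₂, bondPairMat_transpose]
  rfl

/-- the transpose of the swapped vertex: all four swaps at once, `(i,j,k,l,a,b) ↦ K22 τ t j i l k b a d c`. [folklore] -/
theorem wilsonVertex₂_swap_transpose (τ : 𝔸 →ₗ[ℝ] ℝ) (t : C → 𝔸) (e : D → Λ) (p₁ p₂ : Λ × (C × D)) :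
    (wilsonVertex₂ τ t e p₂ p₁)ᵀ
      = bondPairMat e p₁.1 p₁.2.2 p₂.1 p₂.2.2 (fun i j k l a b => K22 τ t j i l k b a p₂.2.1 p₁.2.1) := by
  rw [wilsonVertex₂_swap, bondPairMat_transpose]

end Vertex

/-! ## §3 Polarisation: the symmetrised vertex is the mixed fourth derivative -/

section Polar

variable {𝔸 : Type*} [NormedRing 𝔸] [NormedAlgebra ℝ 𝔸]
variable {Λ : Type*} [Fintype Λ] [DecidableEq Λ] [AddCommGroup Λ] {C : Type*} [Fintype C] {D : Type*} [Fintype D] [DecidableEq D]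

/-- **`B`-SIDE POLARISATION OF THE HESSIAN**: on a finite torus,
`hess22 (field t (u + u′)) − hess22 (field t u) − hess22 (field t u′) = Σ_{p₁} Σ_{p₂} (u p₁ · u′ p₂) • (wilsonVertex₂ p₁ p₂ + wilsonVertex₂ p₂ p₁)` —
the symmetric `B`-bilinear form of the `(2,2)`-jet has the SYMMETRISED Wilson vertex as its coefficient matrix (any algebra, any real-linear
`τ`, any letters). [folklore] -/
theorem hess22_polar (τ : 𝔸 →ₗ[ℝ] ℝ) (t : C → 𝔸) (e : D → Λ) (u u' : Λ × (C × D) → ℝ) :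
    hess22 τ t e (field t (u + u')) - hess22 τ t e (field t u) - hess22 τ t e (field t u')
      = ∑ p₁ : Λ × (C × D), ∑ p₂ : Λ × (C × D), (u p₁ * u' p₂) • (wilsonVertex₂ τ t e p₁ p₂ + wilsonVertex₂ τ t e p₂ p₁) := by
  rw [hess22_field_eq_sum_wilsonVertex₂, hess22_field_eq_sum_wilsonVertex₂, hess22_field_eq_sum_wilsonVertex₂]
  have key : ∀ p₁ p₂ : Λ × (C × D), ((u + u') p₁ * (u + u') p₂) • wilsonVertex₂ τ t e p₁ p₂
      = (u p₁ * u p₂) • wilsonVertex₂ τ t e p₁ p₂ + (u' p₁ * u' p₂) • wilsonVertex₂ τ t e p₁ p₂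
        + ((u p₁ * u' p₂) • wilsonVertex₂ τ t e p₁ p₂ + (u' p₁ * u p₂) • wilsonVertex₂ τ t e p₁ p₂) := by
    intro p₁ p₂
    simp only [Pi.add_apply, ← add_smul]
    congr 1
    ring
  simp only [key, Finset.sum_add_distrib]
  have hsw : ∑ p₁ : Λ × (C × D), ∑ p₂ : Λ × (C × D), (u' p₁ * u p₂) • wilsonVertex₂ τ t e p₁ p₂
      = ∑ p₁ : Λ × (C × D), ∑ p₂ : Λ × (C × D), (u p₁ * u' p₂) • wilsonVertex₂ τ t e p₂ p₁ := by
    rw [Finset.sum_comm]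
    exact Finset.sum_congr rfl fun p₁ _ => Finset.sum_congr rfl fun p₂ _ => by rw [mul_comm]
  rw [hsw]
  simp only [smul_add, Finset.sum_add_distrib]
  abel

/-- POLARISATION OF A QUADRATIC FORM: `(v + v′)ᵀM(v + v′) − vᵀMv − v′ᵀMv′ = vᵀ(M + Mᵀ)v′`. [folklore] -/
theorem dotProduct_mulVec_polar {n : Type*} [Fintype n] (M : Matrix n n ℝ) (v v' : n → ℝ) :
    (v + v') ⬝ᵥ (M *ᵥ (v + v')) - v ⬝ᵥ (M *ᵥ v) - v' ⬝ᵥ (M *ᵥ v') = v ⬝ᵥ ((M + Mᵀ) *ᵥ v') := by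
  have ht : v ⬝ᵥ (Mᵀ *ᵥ v') = v' ⬝ᵥ (M *ᵥ v) := by
    rw [Matrix.mulVec_transpose, Matrix.dotProduct_mulVec, dotProduct_comm]
  rw [Matrix.add_mulVec, dotProduct_add, ht, Matrix.mulVec_add, add_dotProduct, dotProduct_add, dotProduct_add]
  ring

/-- **`W`-SIDE POLARISATION OF THE `(2,2)`-JET** (τ tracial): `jet22 (field t (v + v′)) B − jet22 (field t v) B − jet22 (field t v′) B
= v ⬝ᵥ (hess22 B + (hess22 B)ᵀ) *ᵥ v′`. [folklore] -/
theorem jet22_polar_left (τ : 𝔸 →ₗ[ℝ] ℝ) (hτ : ∀ a b : 𝔸, τ (a * b) = τ (b * a)) (t : C → 𝔸) (e : D → Λ)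
    (v v' : Λ × (C × D) → ℝ) (B : Λ → D → 𝔸) :
    jet22 ℝ τ e (field t (v + v')) B - jet22 ℝ τ e (field t v) B - jet22 ℝ τ e (field t v') B
      = v ⬝ᵥ ((hess22 τ t e B + (hess22 τ t e B)ᵀ) *ᵥ v') := by
  rw [jet22_field_quadForm τ hτ, jet22_field_quadForm τ hτ, jet22_field_quadForm τ hτ]
  exact dotProduct_mulVec_polar _ v v'

/-- **THE SYMMETRIC HESSIAN THROUGH THE VERTICES**: `hess22 (field t u) + (hess22 (field t u))ᵀ = Σ (u p₁ · u p₂) • (V p₁ p₂ + (V p₁ p₂)ᵀ)`. [folklore] -/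
theorem hess22_add_transpose_field (τ : 𝔸 →ₗ[ℝ] ℝ) (t : C → 𝔸) (e : D → Λ) (u : Λ × (C × D) → ℝ) :
    hess22 τ t e (field t u) + (hess22 τ t e (field t u))ᵀ
      = ∑ p₁ : Λ × (C × D), ∑ p₂ : Λ × (C × D), (u p₁ * u p₂) • (wilsonVertex₂ τ t e p₁ p₂ + (wilsonVertex₂ τ t e p₁ p₂)ᵀ) := by
  rw [hess22_field_eq_sum_wilsonVertex₂]
  simp only [Matrix.transpose_sum, Matrix.transpose_smul, smul_add, Finset.sum_add_distrib]

end Polar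

/-! ## §4 The closed form of the symmetrised colour-traced table -/

section Closed

/-- the INTEGER MIRROR of the accumulated-background table `PlaquetteVertex2Polar.inc` (for kernel decisions by `decide`). [folklore] -/
def incZ : Fin 4 → Fin 4 → ℤ := ![![0, 0, 0, 0], ![1, 0, 0, 0], ![1, 1, -1, 0], ![1, 1, -1, -1]]

/-- the integer mirror of the orientation signs `PlaquetteVertex2Coords.sgn`. [folklore] -/
def sgnZ : Fin 4 → ℤ := ![1, 1, -1, -1]

/-- `inc` is the cast of its integer mirror. [folklore] -/
theorem inc_eq_cast (i k : Fin 4) : inc i k = ((incZ i k : ℤ) : ℝ) := by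
  fin_cases i <;> fin_cases k <;> simp [inc, incZ]

/-- `sgn` is the cast of its integer mirror. [folklore] -/
theorem sgn_eq_cast (i : Fin 4) : sgn i = ((sgnZ i : ℤ) : ℝ) := by
  fin_cases i <;> simp [sgn, sgnZ]

/-- **THE INTERLEAVING INDICATOR** `chi i j k l := ((inc_{ik} − inc_{jk})² − (inc_{il} − inc_{jl})²)²`: `1` iff exactly one of the background
positions `k, l` lies between the fluctuation positions `i, j` on the plaquette path, else `0`. [folklore] -/
def chi (i j k l : Fin 4) : ℝ := ((inc i k - inc j k) ^ 2 - (inc i l - inc j l) ^ 2) ^ 2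

/-- the integer mirror of `chi`. [folklore] -/
def chiZ (i j k l : Fin 4) : ℤ := ((incZ i k - incZ j k) ^ 2 - (incZ i l - incZ j l) ^ 2) ^ 2

/-- `chi` is the cast of its integer mirror. [folklore] -/
theorem chi_eq_cast (i j k l : Fin 4) : chi i j k l = ((chiZ i j k l : ℤ) : ℝ) := by
  simp only [chi, chiZ, inc_eq_cast]
  push_cast
  ring

/-- the interleaving indicator takes the values `0` and `1` only (256 quadruples, decided over `ℤ`). [folklore] -/
theorem chiZ_eq_zero_or_eq_one : ∀ i j k l : Fin 4, chiZ i j k l = 0 ∨ chiZ i j k l = 1 := by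
  decide

/-- `chi` takes the values `0` and `1` only. [folklore] -/
theorem chi_eq_zero_or_eq_one (i j k l : Fin 4) : chi i j k l = 0 ∨ chi i j k l = 1 := by
  rcases chiZ_eq_zero_or_eq_one i j k l with h | h
  · left
    rw [chi_eq_cast, h, Int.cast_zero]
  · right
    rw [chi_eq_cast, h, Int.cast_one]

/-- `chi` is symmetric in the fluctuation slots. [folklore] -/
theorem chi_swap_left (i j k l : Fin 4) : chi j i k l = chi i j k l := by
  unfold chi
  ring

/-- `chi` is symmetric in the background slots. [folklore] -/
theorem chi_swap_right (i j k l : Fin 4) : chi i j l k = chi i j k l := by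
  unfold chi
  ring

/-- `chi` vanishes on the fluctuation diagonal. [folklore] -/
theorem chi_diag_left (i k l : Fin 4) : chi i i k l = 0 := by
  simp [chi]

/-- `chi` vanishes on the background diagonal. [folklore] -/
theorem chi_diag_right (i j k : Fin 4) : chi i j k k = 0 := by
  simp [chi]

/-- the fluctuation pair `(0, 3)` — the two bonds at the base point — never interleaves (decided over `ℤ`). [folklore] -/
theorem chiZ_zero_three : ∀ k l : Fin 4, chiZ 0 3 k l = 0 := by
  decide

/-- `chi 0 3 k l = 0`. [folklore] -/
theorem chi_zero_three (k l : Fin 4) : chi 0 3 k l = 0 := by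
  rw [chi_eq_cast, chiZ_zero_three, Int.cast_zero]

/-- exactly `64` of the `256` position quadruples interleave (decided over `ℤ`). [folklore] -/
theorem sum_chiZ : ∑ i : Fin 4, ∑ j : Fin 4, ∑ k : Fin 4, ∑ l : Fin 4, chiZ i j k l = 64 := by
  decide

/-- **THE SYMMETRISED TRACED TABLE IN CLOSED FORM** `wsym22 N i j k l := s_i s_j s_k s_l · ((N² − 1) − N²·chi i j k l)`. [folklore] -/
def wsym22 (N : ℕ) (i j k l : Fin 4) : ℝ := sgn i * sgn j * sgn k * sgn l * (((N : ℝ) ^ 2 - 1) - (N : ℝ) ^ 2 * chi i j k l)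

/-- OFF THE INTERLEAVING SET the symmetrised traced weight is `(N² − 1)·s_i s_j s_k s_l`. [folklore] -/
theorem wsym22_of_chi_eq_zero (N : ℕ) {i j k l : Fin 4} (h : chi i j k l = 0) :
    wsym22 N i j k l = ((N : ℝ) ^ 2 - 1) * (sgn i * sgn j * sgn k * sgn l) := by
  rw [wsym22, h]
  ring

/-- ON THE INTERLEAVING SET the symmetrised traced weight is the `N`-free integer `−s_i s_j s_k s_l`. [folklore] -/
theorem wsym22_of_chi_eq_one (N : ℕ) {i j k l : Fin 4} (h : chi i j k l = 1) :
    wsym22 N i j k l = -(sgn i * sgn j * sgn k * sgn l) := by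
  rw [wsym22, h]
  ring

/-- THE TWO `N`-PARTS OF THE CLOSED FORM: `wsym22 N = (N² − 1)·(s⊗s⊗s⊗s) − N²·(s⊗s⊗s⊗s·chi)`. [folklore] -/
theorem wsym22_eq_sub (N : ℕ) (i j k l : Fin 4) :
    wsym22 N i j k l = ((N : ℝ) ^ 2 - 1) * (sgn i * sgn j * sgn k * sgn l)
      - (N : ℝ) ^ 2 * (sgn i * sgn j * sgn k * sgn l * chi i j k l) := by
  unfold wsym22
  ring

/-- `wsym22` is symmetric in the fluctuation slots. [folklore] -/
theorem wsym22_swap_left (N : ℕ) (i j k l : Fin 4) : wsym22 N j i k l = wsym22 N i j k l := by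
  rw [wsym22, wsym22, chi_swap_left]
  ring

/-- `wsym22` is symmetric in the background slots. [folklore] -/
theorem wsym22_swap_right (N : ℕ) (i j k l : Fin 4) : wsym22 N i j l k = wsym22 N i j k l := by
  rw [wsym22, wsym22, chi_swap_right]
  ring

/-- the position-diagonal of the closed form: `wsym22 N i i k l = (N² − 1)·s_k s_l` (consistent with `PlaquetteVertex2Trace.sum_w22_diag`). [folklore] -/
theorem wsym22_diag_left (N : ℕ) (i k l : Fin 4) : wsym22 N i i k l = ((N : ℝ) ^ 2 - 1) * (sgn k * sgn l) := by
  rw [wsym22_of_chi_eq_zero N (chi_diag_left i k l)]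
  have hs : sgn i * sgn i = 1 := by fin_cases i <;> simp [sgn]
  rw [show sgn i * sgn i * sgn k * sgn l = sgn i * sgn i * (sgn k * sgn l) from by ring, hs, one_mul]

/-- the `N`-free `N²`-table of `w22` (`PlaquetteVertex2Trace.w22_eq_sq_add`). [folklore] -/
def a22 (i j k l : Fin 4) : ℝ :=
  sgn i * sgn j * ((inc j k - inc i k) * (inc j l - 2⁻¹ * sgn l) + if i < j then (inc i k - inc j k) * sgn l else 0)

/-- the `N`-free `(N² − 1)`-table of `w22`. [folklore] -/
def b22 (i j k l : Fin 4) : ℝ := sgn i * sgn j * (2⁻¹ * qq k l)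

/-- `w22 N = N²·a22 + (N² − 1)·b22` (= `w22_eq_sq_add`). [folklore] -/
theorem w22_eq_a22_add_b22 (N : ℕ) (i j k l : Fin 4) :
    w22 N i j k l = (N : ℝ) ^ 2 * a22 i j k l + ((N : ℝ) ^ 2 - 1) * b22 i j k l :=
  w22_eq_sq_add N i j k l

/-- the integer mirror of `2·a22`. [folklore] -/
def a22Z (i j k l : Fin 4) : ℤ :=
  sgnZ i * sgnZ j * ((incZ j k - incZ i k) * (2 * incZ j l - sgnZ l) + if i < j then 2 * ((incZ i k - incZ j k) * sgnZ l) else 0)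

/-- `2·a22` is the cast of its integer mirror. [folklore] -/
theorem two_mul_a22_eq_cast (i j k l : Fin 4) : 2 * a22 i j k l = ((a22Z i j k l : ℤ) : ℝ) := by
  simp only [a22, a22Z, inc_eq_cast, sgn_eq_cast]
  push_cast
  split_ifs <;> ring

/-- THE `N²`-TABLE SYMMETRISES TO MINUS THE SIGNED INTERLEAVING INDICATOR — over `ℤ`, all `256` quadruples, by `decide`. [folklore] -/
theorem a22Z_symm : ∀ i j k l : Fin 4,
    a22Z i j k l + a22Z j i k l + a22Z i j l k + a22Z j i l k = -(2 * (sgnZ i * sgnZ j * sgnZ k * sgnZ l * chiZ i j k l)) := by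
  decide

/-- THE `N²`-TABLE SYMMETRISES TO MINUS THE SIGNED INTERLEAVING INDICATOR (transported to `ℝ`). [folklore] -/
theorem symTab_a22 (i j k l : Fin 4) :
    a22 i j k l + a22 j i k l + a22 i j l k + a22 j i l k = -(sgn i * sgn j * sgn k * sgn l * chi i j k l) := by
  have h' : ((a22Z i j k l + a22Z j i k l + a22Z i j l k + a22Z j i l k : ℤ) : ℝ)
      = ((-(2 * (sgnZ i * sgnZ j * sgnZ k * sgnZ l * chiZ i j k l)) : ℤ) : ℝ) := by
    rw [a22Z_symm i j k l]
  push_cast at h'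
  rw [← two_mul_a22_eq_cast, ← two_mul_a22_eq_cast, ← two_mul_a22_eq_cast, ← two_mul_a22_eq_cast, ← sgn_eq_cast,
    ← sgn_eq_cast, ← sgn_eq_cast, ← sgn_eq_cast, ← chi_eq_cast] at h'
  linarith

/-- THE `(N² − 1)`-TABLE SYMMETRISES TO THE RANK-ONE SIGN TABLE `s_i s_j s_k s_l`. [folklore] -/
theorem symTab_b22 (i j k l : Fin 4) :
    b22 i j k l + b22 j i k l + b22 i j l k + b22 j i l k = sgn i * sgn j * sgn k * sgn l := by
  fin_cases k <;> fin_cases l <;> simp [b22, qq, sgn] <;> ring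

/-- **THE CLOSED FORM, ENTRYWISE**: `w22 i j k l + w22 j i k l + w22 i j l k + w22 j i l k = wsym22 N i j k l`. [folklore] -/
theorem w22_symm_eq (N : ℕ) (i j k l : Fin 4) :
    w22 N i j k l + w22 N j i k l + w22 N i j l k + w22 N j i l k = wsym22 N i j k l := by
  simp only [w22_eq_a22_add_b22]
  have ha := symTab_a22 i j k l
  have hb := symTab_b22 i j k l
  unfold wsym22
  linear_combination ((N : ℝ) ^ 2) * ha + ((N : ℝ) ^ 2 - 1) * hb

/-- **THE CLOSED FORM**: `symTab (w22 N) = wsym22 N`. [folklore] -/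
theorem symTab_w22 (N : ℕ) : symTab (w22 N) = wsym22 N := by
  funext i j k l
  exact w22_symm_eq N i j k l

end Closed

section Traced

attribute [local instance] Matrix.linftyOpNormedRing Matrix.linftyOpNormedAlgebra

variable {N : ℕ} {C : Type*} [Fintype C] [DecidableEq C]

/-- **THE COLOUR-TRACED SYMMETRISED KERNEL**: in Bałaban's letters `gen τ` with the normalised real trace `rntr`, the fluctuation-colour
trace of the four-term symmetrisation of the `(2,2)` kernel (slots AND background letters swapped in the swapped terms, as in
`wilsonVertex₂_swap` / `_transpose`) is `[c = d]·wsym22 N i j k l`. [folklore] -/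
theorem sum_K22_symm_diag {τ : C → Matrix (Fin N) (Fin N) ℂ} (hτ : Complete τ) (ho : TrOrthonormal τ) (hN : N ≠ 0)
    (i j k l : Fin 4) (c d : C) :
    ∑ a, (K22 rntr (gen τ) i j k l a a c d + K22 rntr (gen τ) j i k l a a c d + K22 rntr (gen τ) i j l k a a d c
        + K22 rntr (gen τ) j i l k a a d c)
      = if c = d then wsym22 N i j k l else 0 := by
  simp only [Finset.sum_add_distrib, sum_K22_diag hτ ho hN]
  by_cases hcd : c = d
  · subst hcd
    simp only [if_true]
    exact w22_symm_eq N i j k l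
  · have hdc : ¬ d = c := fun h => hcd h.symm
    simp only [hcd, hdc, if_false, add_zero]

end Traced

/-! ## §5 The consumer's format: swaps of the Wilson fine bi-stencil family -/

section BiStencil

variable {d : ℕ} (T : Fin 4 → Fin 4 → Fin 4 → Fin 4 → ℝ)

/-- PAIR SWAP OF THE FIELD BLOCK: `wEntry₂ d T κ′ u′ κ u = wEntry₂ d (swapKL T) κ u κ′ u′` (entrywise). [folklore] -/
theorem wEntry₂_swap (κ : Fin (d + 1)) (u : Fin (d + 1) → ℤ) (κ' : Fin (d + 1)) (u' : Fin (d + 1) → ℤ) (x z : Fin (d + 1) → ℤ)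
    (α β : Fin (d + 1)) : wEntry₂ d T κ' u' κ u x z α β = wEntry₂ d (swapKL T) κ u κ' u' x z α β := by
  unfold wEntry₂
  rw [bondPairTab_swap]

/-- LEG TRANSPOSITION OF THE FIELD BLOCK: `wEntry₂ d T κ u κ′ u′ z x β α = wEntry₂ d (swapIJ T) κ u κ′ u′ x z α β`. [folklore] -/
theorem wEntry₂_transpose (κ : Fin (d + 1)) (u : Fin (d + 1) → ℤ) (κ' : Fin (d + 1)) (u' : Fin (d + 1) → ℤ) (x z : Fin (d + 1) → ℤ)
    (α β : Fin (d + 1)) : wEntry₂ d T κ u κ' u' z x β α = wEntry₂ d (swapIJ T) κ u κ' u' x z α β := by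
  unfold wEntry₂
  rw [← bondPairTab_transpose, Matrix.transpose_apply]

/-- **PAIR SWAP OF THE FAMILY = BACKGROUND-SLOT SWAP OF THE TABLE**: `wilsonW₂ d T κ′ u′ κ u = wilsonW₂ d (swapKL T) κ u κ′ u′`. [folklore] -/
theorem wilsonW₂_swap (κ : Fin (d + 1)) (u : Fin (d + 1) → ℤ) (κ' : Fin (d + 1)) (u' : Fin (d + 1) → ℤ) :
    wilsonW₂ d T κ' u' κ u = wilsonW₂ d (swapKL T) κ u κ' u' := by
  funext x z a b
  rcases a with α | α <;> rcases b with β | β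
  · exact wEntry₂_swap T κ u κ' u' x z α β
  · rfl
  · rfl
  · rfl

/-- **LEG TRANSPOSITION OF THE FAMILY = FLUCTUATION-SLOT SWAP OF THE TABLE**:
`wilsonW₂ d T κ u κ′ u′ z x b a = wilsonW₂ d (swapIJ T) κ u κ′ u′ x z a b`. [folklore] -/
theorem wilsonW₂_transpose (κ : Fin (d + 1)) (u : Fin (d + 1) → ℤ) (κ' : Fin (d + 1)) (u' : Fin (d + 1) → ℤ)
    (x z : Fin (d + 1) → ℤ) (a b : Fib d) : wilsonW₂ d T κ u κ' u' z x b a = wilsonW₂ d (swapIJ T) κ u κ' u' x z a b := by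
  rcases a with α | α <;> rcases b with β | β
  · exact wEntry₂_transpose T κ u κ' u' x z α β
  · rfl
  · rfl
  · rfl

/-- **THE SYMMETRISED FAMILY IS PAIR-SYMMETRIC**. [folklore] -/
theorem wilsonW₂_symTab_swap (κ : Fin (d + 1)) (u : Fin (d + 1) → ℤ) (κ' : Fin (d + 1)) (u' : Fin (d + 1) → ℤ) :
    wilsonW₂ d (symTab T) κ' u' κ u = wilsonW₂ d (symTab T) κ u κ' u' := by
  rw [wilsonW₂_swap, swapKL_symTab]

/-- **THE SYMMETRISED FAMILY IS LEG-SYMMETRIC** (contrast: first-order families are leg-antisymmetric by convention). [folklore] -/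
theorem wilsonW₂_symTab_transpose (κ : Fin (d + 1)) (u : Fin (d + 1) → ℤ) (κ' : Fin (d + 1)) (u' : Fin (d + 1) → ℤ)
    (x z : Fin (d + 1) → ℤ) (a b : Fib d) :
    wilsonW₂ d (symTab T) κ u κ' u' z x b a = wilsonW₂ d (symTab T) κ u κ' u' x z a b := by
  rw [wilsonW₂_transpose, swapIJ_symTab]

/-- **THE SYMMETRISED FAMILY IS THE FOUR-TERM SYMMETRISATION OF THE ORDERED FAMILY**:
`wilsonW₂ (symTab T) κ u κ′ u′ x z a b = W κ u κ′ u′ x z a b + W κ u κ′ u′ z x b a + W κ′ u′ κ u x z a b + W κ′ u′ κ u z x b a`. [folklore] -/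
theorem wilsonW₂_symTab_apply (κ : Fin (d + 1)) (u : Fin (d + 1) → ℤ) (κ' : Fin (d + 1)) (u' : Fin (d + 1) → ℤ)
    (x z : Fin (d + 1) → ℤ) (a b : Fib d) :
    wilsonW₂ d (symTab T) κ u κ' u' x z a b
      = wilsonW₂ d T κ u κ' u' x z a b + wilsonW₂ d T κ u κ' u' z x b a + wilsonW₂ d T κ' u' κ u x z a b
        + wilsonW₂ d T κ' u' κ u z x b a := by
  rw [symTab_eq_add, wilsonW₂_add, wilsonW₂_add, wilsonW₂_add]
  simp only [Pi.add_apply]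
  rw [← wilsonW₂_transpose T, ← wilsonW₂_swap T, ← wilsonW₂_transpose (swapKL T), ← wilsonW₂_swap T]

/-- THE CONSTANT OF THE SYMMETRISED FAMILY: `wBound₂ d (symTab T) ≤ 4·wBound₂ d T`. [folklore] -/
theorem wBound₂_symTab_le : wBound₂ d (symTab T) ≤ 4 * wBound₂ d T := by
  unfold wBound₂
  rw [mul_left_comm]
  exact mul_le_mul_of_nonneg_left (tabSum_symTab_le T) (by positivity)

/-- **THE BI-LOCALISATION CERTIFICATE OF THE SYMMETRISED FAMILY** with the constant of the ordered one: for every `δ ≥ 0`,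
`BiLoc (wilsonW₂ d (symTab T) κ u κ′ u′) u u (4·wBound₂ d T·e^{8δ}·e^{−δ‖u′−u‖₁}) δ`. [folklore] -/
theorem biLoc_wilsonW₂_symTab {δ : ℝ} (hδ : 0 ≤ δ) (κ : Fin (d + 1)) (u : Fin (d + 1) → ℤ) (κ' : Fin (d + 1))
    (u' : Fin (d + 1) → ℤ) :
    BiLoc (wilsonW₂ d (symTab T) κ u κ' u') u u (4 * wBound₂ d T * Real.exp (8 * δ) * Real.exp (-δ * l1 (u' - u))) δ := by
  intro x z a b
  have h := biLoc_wilsonW₂ (symTab T) hδ κ u κ' u' x z a b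
  refine h.trans ?_
  have hw := wBound₂_symTab_le (d := d) T
  have he : 0 ≤ Real.exp (8 * δ) * Real.exp (-δ * l1 (u' - u)) * Real.exp (-δ * (l1 (x - u) + l1 (z - u))) := by positivity
  calc wBound₂ d (symTab T) * Real.exp (8 * δ) * Real.exp (-δ * l1 (u' - u)) * Real.exp (-δ * (l1 (x - u) + l1 (z - u)))
        = wBound₂ d (symTab T) * (Real.exp (8 * δ) * Real.exp (-δ * l1 (u' - u)) * Real.exp (-δ * (l1 (x - u) + l1 (z - u)))) := by
          ring
    _ ≤ 4 * wBound₂ d T * (Real.exp (8 * δ) * Real.exp (-δ * l1 (u' - u)) * Real.exp (-δ * (l1 (x - u) + l1 (z - u)))) :=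
          mul_le_mul_of_nonneg_right hw he
    _ = _ := by ring

/-- for the Wilson table: the symmetrised family IS the family of the closed-form table `wsym22 N`. [folklore] -/
theorem wilsonW₂_symTab_w22 (N : ℕ) (κ : Fin (d + 1)) (u : Fin (d + 1) → ℤ) (κ' : Fin (d + 1)) (u' : Fin (d + 1) → ℤ) :
    wilsonW₂ d (symTab (w22 N)) κ u κ' u' = wilsonW₂ d (wsym22 N) κ u κ' u' := by
  rw [symTab_w22]

end BiStencil

/-! ## §6 Kernel-checked examples -/

section Examples

/-- an interleaving quadruple: background position `0` lies between fluctuation positions `0` and `1`, position `2` does not. -/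
example : chi 0 1 0 2 = 1 := by
  rw [chi_eq_cast]; exact_mod_cast (show chiZ 0 1 0 2 = 1 by decide)

/-- a non-interleaving quadruple. -/
example : chi 1 2 1 2 = 0 := by
  rw [chi_eq_cast]; exact_mod_cast (show chiZ 1 2 1 2 = 0 by decide)

/-- ON the interleaving set the symmetrised traced weight is `N`-free: `wsym22 N 0 1 0 1 = −1` for every `N`. -/
example (N : ℕ) : wsym22 N 0 1 0 1 = -1 := by
  have h : chi 0 1 0 1 = 1 := by rw [chi_eq_cast]; exact_mod_cast (show chiZ 0 1 0 1 = 1 by decide)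
  rw [wsym22_of_chi_eq_one N h]
  simp [sgn]

/-- OFF the interleaving set it is `±(N² − 1)`: `wsym22 N 0 3 1 2 = N² − 1`. -/
example (N : ℕ) : wsym22 N 0 3 1 2 = (N : ℝ) ^ 2 - 1 := by
  rw [wsym22_of_chi_eq_zero N (chi_zero_three 1 2)]
  simp [sgn]

/-- the closed form at one entry of the Wilson table: `w22 0101 + w22 1001 + w22 0110 + w22 1010 = −1`, for every `N`. -/
example (N : ℕ) : w22 N 0 1 0 1 + w22 N 1 0 0 1 + w22 N 0 1 1 0 + w22 N 1 0 1 0 = -1 := by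
  have h : chi 0 1 0 1 = 1 := by rw [chi_eq_cast]; exact_mod_cast (show chiZ 0 1 0 1 = 1 by decide)
  rw [w22_symm_eq, wsym22_of_chi_eq_one N h]
  simp [sgn]

/-- The SYMMETRISED colour-traced Wilson family in the consumer's `LocStencil₂` shape (constant of the ordered family times `4`). -/
example {d : ℕ} (N : ℕ) {δ : ℝ} (hδ : 0 ≤ δ) :
    ∀ (κ : Fin (d + 1)) (u : Fin (d + 1) → ℤ) (κ' : Fin (d + 1)) (u' : Fin (d + 1) → ℤ),
      BiLoc (wilsonW₂ d (wsym22 N) κ u κ' u') u u (4 * wBound₂ d (w22 N) * Real.exp (8 * δ) * Real.exp (-δ * l1 (u' - u))) δ := by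
  intro κ u κ' u'
  rw [← wilsonW₂_symTab_w22]
  exact biLoc_wilsonW₂_symTab (w22 N) hδ κ u κ' u'

/-- The symmetrised Wilson family is pair-symmetric … -/
example {d : ℕ} (N : ℕ) (κ : Fin (d + 1)) (u : Fin (d + 1) → ℤ) (κ' : Fin (d + 1)) (u' : Fin (d + 1) → ℤ) :
    wilsonW₂ d (wsym22 N) κ' u' κ u = wilsonW₂ d (wsym22 N) κ u κ' u' := by
  rw [← symTab_w22]; exact wilsonW₂_symTab_swap (w22 N) κ u κ' u'

/-- … and leg-symmetric. -/
example {d : ℕ} (N : ℕ) (κ : Fin (d + 1)) (u : Fin (d + 1) → ℤ) (κ' : Fin (d + 1)) (u' : Fin (d + 1) → ℤ)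
    (x z : Fin (d + 1) → ℤ) (a b : Fib d) :
    wilsonW₂ d (wsym22 N) κ u κ' u' z x b a = wilsonW₂ d (wsym22 N) κ u κ' u' x z a b := by
  rw [← symTab_w22]; exact wilsonW₂_symTab_transpose (w22 N) κ u κ' u' x z a b

end Examples

end Literature.MathematicalPhysics.QuantumFieldTheory.Balaban1983to89.Beta.WilsonVertex2Sym

end
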